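import Literature.NumberTheory.Automorphic.HermitianLatticeTreeTransitive                 -- ★ p843174 F0P2-p02 (g9): `forall_isSelfDualLattice_exists_latt_eq_of_selfDualLocus` (hA from a `u k` decomposition)
import Literature.NumberTheory.Automorphic.UnitaryGroupSelfDualLocusRamifiedPlace          -- ★ (r1-B): `exists_mem_unitaryGroupOfForm_mul_of_selfDual_of_ramified`
import HarnessLib

/-!
# The transitivity binders of the Euler relation on the lattice tree at a TAMELY RAMIFIED place, I: (hA) — `U(J)(E_w)` moves the root `L₀ = 𝒪_w²` onto every
# self-dual lattice (Jacobowitz 1962, §8; Bruhat–Tits 1972, §10)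

Topic `NumberTheory/Automorphic`; namespace `Literature.NumberTheory.Automorphic.HermitianLatticeTree`.  THEOREMS ONLY (no definition, no instance, no notation, no named fact,
no `sorry`).  Cell `pub/hodgecm-mathlib`, F0∕P3a, crux H413 = stmt-HodgeConjecture-24833, line «N6nsGerm», (R2) Euler–Poincaré road, RAMIFIED half (census
`F0/P3a/A-p06/g27/CENSUS-R2ram-RamifiedEulerPoincare.A-p06g27.md` §5 (r1-C); LEAD F0P3a-plan (g10) T9-8 (B); seat A-p06 (g27); consumer = binder `hA` of A-p17 (g22)'s
(T3) `natCard_fixedBy_add_eq_natCard_fixedBy_inf_add_one` (`HermitianLatticeTreeEulerRelation`, statement-first 09:17:07Z) at a ramified `w`; the INERT dischargers are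
F0P2-p02 (g9)'s `HermitianLatticeTreeTransitive`).  HONEST LABEL: HC_CM is proved only modulo the printed citations until rung 0 closes.

* **`forall_isSelfDualLattice_exists_latt_eq_of_ramified`** — (hA) VERBATIM at a tamely ramified non-split place `w ∣ v` of a quadratic extension of number fields
  (`he : e(w|v) ≠ 1`, `h2 : 2 ∈ 𝒪_w^×`), for a `σ_w`-hermitian `J ∈ GL₂(𝒪_w)`: `∀ M, IsSelfDualLattice σ_w ↑J M → ∃ u : U(J)(E_w), latt ↑u = M`.

## References
* [Jacobowitz1962] R. Jacobowitz, *Hermitian forms over local fields*, Amer. J. Math. 84 (1962), §8.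
* [BruhatTits1972] F. Bruhat, J. Tits, *Groupes réductifs sur un corps local I*, Publ. IHÉS 41 (1972), §10.
-/

set_option autoImplicit false

noncomputable section

open NumberField IsDedekindDomain
open scoped Matrix ValuativeRel MatrixGroups
open Matrix ValuativeRel

namespace Literature.NumberTheory.Automorphic.HermitianLatticeTree

open Literature.NumberTheory.Automorphic Literature.NumberTheory.Automorphic.UnitaryGroup

/-! ## (hA) at a tamely ramified place -/

section Ramified

variable {F E : Type} [Field F] [NumberField F] [Field E] [NumberField E] [Algebra F E]
  [Algebra.IsQuadraticExtension F E] (c : E ≃ₐ[F] E) {v : HeightOneSpectrum (𝓞 F)} (w : UnitaryGroup.PlacesOver E v)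

/-- **(hA) AT A TAMELY RAMIFIED PLACE**: for `w ∣ v` non-split (`c • w = w`, `c ≠ 1`) and RAMIFIED (`e(w|v) ≠ 1`) with `2 ∈ 𝒪_w^×`, and a `σ_w`-hermitian `J ∈ GL₂(𝒪_w)`,
every self-dual lattice of `(E_w², J)` is `latt ↑u` for some `u ∈ U(J)(E_w)` (★ (r1-B) `exists_mem_unitaryGroupOfForm_mul_of_selfDual_of_ramified`, reshaped by ★
`forall_isSelfDualLattice_exists_latt_eq_of_selfDualLocus`).  (The (hB) reshaping of ★ `HermitianLatticeTreeTransitive` through a similitude `g₁` with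
`formCongr σ g₁ H = ϖ • H` has NO ramified instance — `ϖ • H` is not even `σ_w`-hermitian when `σ_w ϖ = −ϖ`; the ramified (hB), (hI) go through the two
`ϖ`-modular neighbours of the root, next file.)
[cite: Jacobowitz1962, §8] [cite: BruhatTits1972, §10] -/
theorem forall_isSelfDualLattice_exists_latt_eq_of_ramified (hc1 : c ≠ 1) (hw : c • w.1 = w.1)
    (he : v.asIdeal.ramificationIdx' w.1.asIdeal ≠ 1) (h2 : IsUnit (2 : 𝒪[w.1.adicCompletion E]))
    (J : GL (Fin 2) (w.1.adicCompletion E)) (hJ : J ∈ glInt 2 (w.1.adicCompletion E))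
    (hJh : ((J : Matrix (Fin 2) (Fin 2) (w.1.adicCompletion E)).map (galAdicCompletionMap (L := E) c hw))ᵀ = J) :
    ∀ M : Submodule 𝒪[w.1.adicCompletion E] (Fin 2 → w.1.adicCompletion E),
      IsSelfDualLattice (galAdicCompletionMap (L := E) c hw) (J : Matrix (Fin 2) (Fin 2) (w.1.adicCompletion E)) M →
      ∃ u : unitaryGroupOfForm (galAdicCompletionMap (L := E) c hw) (J : Matrix (Fin 2) (Fin 2) (w.1.adicCompletion E)),
        latt ((u : GL (Fin 2) (w.1.adicCompletion E)) : Matrix (Fin 2) (Fin 2) (w.1.adicCompletion E)) = M :=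
  forall_isSelfDualLattice_exists_latt_eq_of_selfDualLocus (galAdicCompletionMap (L := E) c hw) (J : Matrix (Fin 2) (Fin 2) (w.1.adicCompletion E))
    fun g hg => exists_mem_unitaryGroupOfForm_mul_of_selfDual_of_ramified c w hc1 hw he h2 J hJ hJh g hg

end Ramified

end Literature.NumberTheory.Automorphic.HermitianLatticeTree

end
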